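import Literature.NumberTheory.LFunctions.RHClassicalEquivalents
import Literature.NumberTheory.LFunctions.VonKochConverse
import Literature.NumberTheory.LFunctions.VonKochTheorem
import HarnessLib

/-!
# rh.S19 discharged: `RH ↔ ψ(x) = x + O(x^{1/2} log² x) ↔ θ(x) = x + O(x^{1/2} log² x)`

Trunk T-ANT (`NumberTheory/LFunctions`), family RH. Companion ("Proofs") file of
`Literature/NumberTheory/LFunctions/RHClassicalEquivalents.lean` for its two **rh.S19** named facts
`Literature.NumberTheory.LFunctions.riemannHypothesis_iff_chebyshevPsi_isBigO` and
`Literature.NumberTheory.LFunctions.riemannHypothesis_iff_chebyshevTheta_isBigO` (von Koch's criterion; H. von Koch,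
Acta Math. 24 (1901); Montgomery–Vaughan, *Multiplicative Number Theory I*, Thm. 13.1,
eqs. (13.2)–(13.3), for `⇒`, and §15.1, p. 354, with Thm. 1.3 for `⇐`). The sibling file
`RHClassicalEquivalentsProofs.lean` discharges the Báez-Duarte fact rh.S27 of the same statement
file and is independent of this one.

* `⇒` is von Koch's theorem, `Literature.NumberTheory.LFunctions.vonKoch_chebyshevPsi_of_riemannHypothesis_holds`
  (`VonKochTheorem.lean`: truncated Perron formula, rectangle residues, zero sums under RH);
* `⇐` (unconditional: `ψ(x) − x = O(x^{1/2+ε})` for all `ε > 0` already gives RH) and the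
  `θ ↔ ψ` transfer (`ψ − θ ≪ √x log x`, Mathlib `Chebyshev.isBigO_psi_sub_theta_sqrt`) are
  `Literature.RH.riemannHypothesis_iff_chebyshev{Psi,Theta}_isBigO_of_vonKoch` (`VonKochConverse.lean`:
  Mellin continuation of `−ζ'/ζ(s) − ζ(s)` to `Re s > 1/2` and the identity theorem).

## Main results

* `Literature.NumberTheory.LFunctions.riemannHypothesis_iff_chebyshevPsi_isBigO_holds` — discharge of the `ψ` form;
* `Literature.NumberTheory.LFunctions.riemannHypothesis_iff_chebyshevTheta_isBigO_holds` — discharge of the `θ` form.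

Both depend only on the axioms `propext`, `Classical.choice`, `Quot.sound`.
The file has no definitions.

## References

* H. von Koch, *Sur la distribution des nombres premiers*, Acta Math. 24 (1901), 159–182
  (doi:10.1007/BF02403071), main theorem.
* H. L. Montgomery, R. C. Vaughan, *Multiplicative Number Theory I. Classical Theory*,
  Cambridge Studies in Advanced Mathematics 97, CUP 2007, Thm. 13.1 (p. 322) and §15.1 (p. 354).
-/

namespace Literature.NumberTheory.LFunctions

/-- **rh.S19, `ψ` form, proved**: `RH ↔ ψ(x) − x = O(x^{1/2} log² x)` (von Koch 1901;
Montgomery–Vaughan Thm. 13.1, eq. (13.2), and §15.1 p. 354). [cite: Koch1901, main theorem] -/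
theorem riemannHypothesis_iff_chebyshevPsi_isBigO_holds :
    riemannHypothesis_iff_chebyshevPsi_isBigO :=
  riemannHypothesis_iff_chebyshevPsi_isBigO_of_vonKoch vonKoch_chebyshevPsi_of_riemannHypothesis_holds

/-- **rh.S19, `θ` form, proved**: `RH ↔ θ(x) − x = O(x^{1/2} log² x)` (von Koch 1901;
Montgomery–Vaughan Thm. 13.1, eq. (13.3), and §15.1 p. 354). [cite: Koch1901, main theorem (θ form)] -/
theorem riemannHypothesis_iff_chebyshevTheta_isBigO_holds :
    riemannHypothesis_iff_chebyshevTheta_isBigO :=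
  riemannHypothesis_iff_chebyshevTheta_isBigO_of_vonKoch
    vonKoch_chebyshevPsi_of_riemannHypothesis_holds

end Literature.NumberTheory.LFunctions
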